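import Mathlib
import Summits.ABC.ABC.Theses.CuspFieldPencil
import Literature.NumberTheory.Congruences.FibonacciPrimeEntry
import Literature.NumberTheory.ContinuedFractions.FibonacciLucasNumbers

/-!
# STUB-IDEAS sketch — ideator k=3 (gen 2, FAMILY 3: probe the extremes) for `stub_splitCuspTriple`
# of crux stmt-ABC-26026 `GoldenCuspShadow` (route-ABC-CuspFieldPencil)

Elaboration sanity only: helper-lemma STATEMENTS (`sorry` proofs) for PLAN B (the 5-adic extremal
pencil `Q ∣ 125` = the Fibonacci/Lucas families, decided unconditionally) and the slice assemblies.
Not a proposal; nothing here is landed.  Plan A (mod-Scoones closure of the full stub) is typed in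
ideator-2's `STUB_IDEAS_stub_splitCuspTriple_2.lean` and is not repeated here.
-/

set_option linter.dupNamespace false
set_option linter.unusedVariables false

namespace Summit.ABC.ABC.Cruxes.GoldenCuspShadow.SplitCuspIdeas3

open UniqueFactorizationMonoid

/-- The registered stub, verbatim (`Sig.stub_splitCuspTriple` of the birth skeleton). -/
def StubSplit : Prop :=
  ∀ ε : ℝ, 0 < ε → ∃ κ : ℝ, ∀ u w : ℤ, IsCoprime u w → u * w * (u ^ 2 - 11 * u * w - w ^ 2) ≠ 0 → Real.log (max (|(u : ℝ)|) (|(w : ℝ)|)) ≤ κ * (((UniqueFactorizationMonoid.radical (u * w * (u ^ 2 - 11 * u * w - w ^ 2))).natAbs : ℕ) : ℝ) ^ (ε : ℝ) * (((((UniqueFactorizationMonoid.radical u).natAbs : ℕ) : ℝ) * (((UniqueFactorizationMonoid.radical w).natAbs : ℕ) : ℝ)) ^ (2 / 3 : ℝ) * (((UniqueFactorizationMonoid.radical (u ^ 2 - 11 * u * w - w ^ 2)).natAbs : ℕ) : ℝ) ^ (1 / 3 : ℝ))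

/-- The crux (by name). -/
example : Prop := Summit.ABC.ABC.Theses.CuspFieldPencil.GoldenCuspShadow

/-! ## PLAN B — the 5-adic extremal pencil `P₅ = {Q ∣ 125}` -/

/-- B1. `4Q = (2u − 11w)² − 125w²`: for coprime `u, w`, `5 ∣ Q ⇒ v₅(Q) ∈ {2, 3}`. -/
theorem five_adic_shape {u w : ℤ} (h : IsCoprime u w) (h5 : (5 : ℤ) ∣ u ^ 2 - 11 * u * w - w ^ 2) :
    (25 : ℤ) ∣ u ^ 2 - 11 * u * w - w ^ 2 ∧ ¬ (625 : ℤ) ∣ u ^ 2 - 11 * u * w - w ^ 2 := by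
  sorry

/-- B1'. Hence `rad Q ∣ 5` (all prime factors of `Q` equal `5`) forces `Q ∣ 125`. -/
theorem dvd_125_of_primeFactors {u w : ℤ} (h : IsCoprime u w) (h0 : u ^ 2 - 11 * u * w - w ^ 2 ≠ 0)
    (h5 : ∀ p : ℕ, p.Prime → (p : ℤ) ∣ u ^ 2 - 11 * u * w - w ^ 2 → p = 5) :
    u ^ 2 - 11 * u * w - w ^ 2 ∣ 125 := by
  sorry

/-- Integer-indexed Lucas numbers `L_n = F_{n−1} + F_{n+1}` (`Int.fib` handles `n < 0`). -/
def intLucas (n : ℤ) : ℤ := Int.fib (n - 1) + Int.fib (n + 1)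

/-- The three signed families: `x₊ = u − φ⁵w ∈ {±5φⁿ, ±φⁿ, ±5√5·φⁿ}` read off in the basis `1, φ`
(`φ⁵ = 5φ + 3`, `5F_{n−1} − 3F_n = F_{n−5}`):  `Q = ∓25`, `Q = ±1` (then `5 ∣ n`), `Q = ±125`. -/
def InFivePencilFamily (u w : ℤ) : Prop :=
  ∃ n s : ℤ, (s = 1 ∨ s = -1) ∧
    ((u = s * Int.fib (n - 5) ∧ w = -s * Int.fib n) ∨
     (5 * u = s * Int.fib (n - 5) ∧ 5 * w = -s * Int.fib n) ∨
     (u = s * intLucas (n - 5) ∧ w = -s * intLucas n))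

/-- B2a (descent size). `(u − 11w)·u = w² + Q`; with `|Q| ≤ 125`, `|w| ≥ 4`, `|u| > |w|` a three-way
sign/size case split gives `|u − 11w| < |w|`. -/
theorem descent_lt {u w c : ℤ} (hc : u ^ 2 - 11 * u * w - w ^ 2 = c) (hc' : |c| ≤ 125)
    (hw : 4 ≤ |w|) (huw : |w| < |u|) : |u - 11 * w| < |w| := by
  sorry

/-- B2b (ascent step = index shift `n ↦ n − 5`, `s ↦ −s`; uses `F_n = 11F_{n−5} + F_{n−10}`,
same recurrence for `F/5` and `L`). -/
theorem family_of_descent {u w : ℤ} (h : InFivePencilFamily w (u - 11 * w)) :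
    InFivePencilFamily u w := by
  sorry

/-- B2c (swap = reflection `n ↦ 5 − n` via `F_{−k} = (−1)^{k+1}F_k`, `L_{−k} = (−1)^k L_k`; sign). -/
theorem family_swap {u w : ℤ} (h : InFivePencilFamily u w) : InFivePencilFamily w (-u) := by
  sorry

theorem family_neg {u w : ℤ} (h : InFivePencilFamily u w) : InFivePencilFamily (-u) (-w) := by
  sorry

/-- B2d (base box: `|w| ≤ 3` forces `|u| ≤ 45`; finite table of `(n, s)` witnesses). -/
theorem family_base {u w : ℤ} (h : IsCoprime u w) (hQ : u ^ 2 - 11 * u * w - w ^ 2 ∣ 125)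
    (hw : |w| ≤ 3) : InFivePencilFamily u w := by
  sorry

/-- B2 (classification of the 5-adic pencil): strong induction on `max |u| |w|` from B2a–B2d. -/
theorem classification {u w : ℤ} (h : IsCoprime u w) (hQ : u ^ 2 - 11 * u * w - w ^ 2 ∣ 125) :
    InFivePencilFamily u w := by
  sorry

/-! ### Rank of apparition and primitive prime divisors -/

/-- B3. A prime whose rank of apparition is `n` satisfies `n ∣ p − (5/p)` hence `n ≤ p + 1`
(tree: `FibonacciPrime.prime_dvd_fib` + `Nat.fib_gcd`). -/
theorem le_succ_of_rank_eq {p n : ℕ} (hp : p.Prime) (hn : 0 < n) (hpn : p ∣ Nat.fib n)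
    (hmin : ∀ d, 0 < d → d < n → ¬ p ∣ Nat.fib d) : n ≤ p + 1 := by
  sorry

/-- B4 (named fact, cite-only). Carmichael 1913, Thm XXIII: `F_n` has a primitive prime divisor for
`n ∉ {1, 2, 6, 12}` — here only `n > 12`. [cite: Carmichael1913, Thm XXIII] -/
def Carmichael1913FibPrimitiveDivisor : Prop :=
  ∀ n : ℕ, 12 < n → ∃ p : ℕ, p.Prime ∧ p ∣ Nat.fib n ∧ ∀ d : ℕ, 0 < d → d < n → ¬ p ∣ Nat.fib d

/-- B4e (elementary substitute, step 1): `F_{km} ≡ k·F_{m−1}^{k−1}·F_m (mod F_m²)`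
(induction on `k` with `Nat.fib_add`). -/
theorem fib_mul_modEq {m : ℕ} (hm : 1 ≤ m) (k : ℕ) :
    Nat.fib (k * m) ≡ k * Nat.fib (m - 1) ^ (k - 1) * Nat.fib m [MOD Nat.fib m ^ 2] := by
  sorry

/-- B4e (step 2): a prime dividing `F_{ℓ^j}` but not `F_{ℓ^{j−1}}` exists once `ℓ^j ≥ 3`
(`gcd(F_{ℓm}/F_m, F_m) ∣ ℓ` from B4e step 1, and `ℓ ∤ F_{ℓ^{j−1}}` unless `ℓ = 5`, where `v₅` is exact). -/
theorem exists_prime_dvd_fib_primePow {ℓ j : ℕ} (hℓ : ℓ.Prime) (hj : 1 ≤ j) (h3 : 3 ≤ ℓ ^ j) :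
    ∃ q : ℕ, q.Prime ∧ q ∣ Nat.fib (ℓ ^ j) ∧ ¬ q ∣ Nat.fib (ℓ ^ (j - 1)) := by
  sorry

/-- B5e. `φ(n) ≤ rad(F_n)`: the primes of B4e for the distinct `ℓ^j ∥ n` have distinct ranks `ℓ^j`,
each `≥ ℓ^j − 1 ≥ φ(ℓ^j)` by B3, and all divide `F_n`. -/
theorem totient_le_radical_fib {n : ℕ} (hn : 1 ≤ n) :
    Nat.totient n ≤ UniqueFactorizationMonoid.radical (Nat.fib n) := by
  sorry

/-- B5e'. `n⁴ ≤ 48·φ(n)⁵` (multiplicativity; only `p = 2, 3` cost a constant). -/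
theorem pow_four_le_totient_pow_five (n : ℕ) : n ^ 4 ≤ 48 * Nat.totient n ^ 5 := by
  sorry

/-- B5 (from the fact): `n − 1 ≤ rad(F_n)` for `n > 12`, and `2n − 1 ≤ rad(L_n)` via `L_n = F_{2n}/F_n`. -/
theorem pred_le_radical_fib (hC : Carmichael1913FibPrimitiveDivisor) {n : ℕ} (hn : 12 < n) :
    n - 1 ≤ UniqueFactorizationMonoid.radical (Nat.fib n) := by
  sorry

theorem le_radical_lucas (hC : Carmichael1913FibPrimitiveDivisor) {n : ℕ} (hn : 6 < n) :
    2 * n - 1 ≤ UniqueFactorizationMonoid.radical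
      (Literature.NumberTheory.ContinuedFractions.FibonacciLucas.lucas n) := by
  sorry

/-! ### Bridges and sizes -/

/-- B6a. `(rad z).natAbs = rad |z|` (Mathlib `Int.radical_natAbs_eq_radical`). -/
theorem natAbs_radical (z : ℤ) :
    (UniqueFactorizationMonoid.radical z).natAbs = UniqueFactorizationMonoid.radical z.natAbs := by
  sorry

/-- B6b. `|Int.fib n| = F_{|n|}` and `|intLucas n| = L_{|n|}`. -/
theorem natAbs_intFib (n : ℤ) : (Int.fib n).natAbs = Nat.fib n.natAbs := by
  sorry

theorem natAbs_intLucas (n : ℤ) :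
    (intLucas n).natAbs = Literature.NumberTheory.ContinuedFractions.FibonacciLucas.lucas n.natAbs := by
  sorry

/-- B6c. Sizes: `F_n ≤ 2^n`, `L_n ≤ 2^(n+1)`. -/
theorem fib_le_two_pow (n : ℕ) : Nat.fib n ≤ 2 ^ n := by
  sorry

theorem lucas_le_two_pow_succ (n : ℕ) :
    Literature.NumberTheory.ContinuedFractions.FibonacciLucas.lucas n ≤ 2 ^ (n + 1) := by
  sorry

/-! ### Slice assemblies (what lands `--supports stmt-ABC-26026`) -/

/-- B7. The stub's inequality on the 5-adic pencil, with `ε = 0` and WITHOUT the `rad(Q)^{1/3}` factor: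
`log max(|u|,|w|) ≤ κ·(rad u · rad w)^{2/3}` whenever `Q ∣ 125`.  Route 1: from `hC` via B2, B5, B6
(`rad u·rad w ≥ (|n|−6)(|n|−1)/…`, `log H ≤ (|n|+6)·log 2`); route 2 (fully elementary): B2, B5e, B5e', B6. -/
theorem splitCusp_on_fivePencil (hC : Carmichael1913FibPrimitiveDivisor) :
    ∃ κ : ℝ, ∀ u w : ℤ, IsCoprime u w → u * w * (u ^ 2 - 11 * u * w - w ^ 2) ≠ 0 →
      u ^ 2 - 11 * u * w - w ^ 2 ∣ 125 →
      Real.log (max (|(u : ℝ)|) (|(w : ℝ)|)) ≤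
        κ * ((((UniqueFactorizationMonoid.radical u).natAbs : ℕ) : ℝ) *
              (((UniqueFactorizationMonoid.radical w).natAbs : ℕ) : ℝ)) ^ (2 / 3 : ℝ) := by
  sorry

/-- B7 ⇒ the stub restricted to the pencil (extra factors are `≥ 1`). -/
theorem stubSplit_on_fivePencil (hC : Carmichael1913FibPrimitiveDivisor) :
    ∀ ε : ℝ, 0 < ε → ∃ κ : ℝ, ∀ u w : ℤ, IsCoprime u w → u * w * (u ^ 2 - 11 * u * w - w ^ 2) ≠ 0 →
      u ^ 2 - 11 * u * w - w ^ 2 ∣ 125 →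
      Real.log (max (|(u : ℝ)|) (|(w : ℝ)|)) ≤ κ * (((UniqueFactorizationMonoid.radical (u * w * (u ^ 2 - 11 * u * w - w ^ 2))).natAbs : ℕ) : ℝ) ^ (ε : ℝ) * (((((UniqueFactorizationMonoid.radical u).natAbs : ℕ) : ℝ) * (((UniqueFactorizationMonoid.radical w).natAbs : ℕ) : ℝ)) ^ (2 / 3 : ℝ) * (((UniqueFactorizationMonoid.radical (u ^ 2 - 11 * u * w - w ^ 2)).natAbs : ℕ) : ℝ) ^ (1 / 3 : ℝ)) := by
  sorry

/-- B7''. The CRUX inequality on the pencil at the endpoint exponent `1/2` (no `ε`):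
`rad(uwQ) = 5^{0/1}·rad u·rad w ≥ (|n|−6)(|n|−1)` is quadratic in the index while `log H` is linear. -/
theorem goldenCuspShadow_on_fivePencil (hC : Carmichael1913FibPrimitiveDivisor) :
    ∃ κ : ℝ, ∀ u w : ℤ, IsCoprime u w → u * w * (u ^ 2 - 11 * u * w - w ^ 2) ≠ 0 →
      u ^ 2 - 11 * u * w - w ^ 2 ∣ 125 →
      Real.log (max (|(u : ℝ)|) (|(w : ℝ)|)) ≤
        κ * (((UniqueFactorizationMonoid.radical (u * w * (u ^ 2 - 11 * u * w - w ^ 2))).natAbs : ℕ) : ℝ) ^ (1 / 2 : ℝ) := by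
  sorry

/-- B8 (real-analysis glue, one `rpow` step): `a·m ≤ κ·X^{2/3}` from `m³ ≤ C·X²`. -/
theorem linear_le_rpow_two_thirds {m X C a : ℝ} (hm : 0 ≤ m) (hX : 1 ≤ X) (hC : 0 ≤ C) (ha : 0 ≤ a)
    (h : m ^ 3 ≤ C * X ^ 2) : a * m ≤ a * C ^ (1 / 3 : ℝ) * X ^ (2 / 3 : ℝ) := by
  sorry

/-! ### Sanity `example`s (small cases of B1/B2 data; `decide`) -/

example : (8 : ℤ) ^ 2 - 11 * 8 * 1 - 1 ^ 2 = -25 := by norm_num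
example : (11 : ℤ) ^ 2 - 11 * 11 * 1 - 1 ^ 2 = -1 := by norm_num
example : (18 : ℤ) ^ 2 - 11 * 18 * 1 - 1 ^ 2 = 125 := by norm_num
example : Int.fib (-6) = -8 ∧ Int.fib (-1) = 1 := by decide
example : InFivePencilFamily 8 1 :=            -- `Q = −25`:  (F₆, F₁), n = −1, s = −1
  ⟨-1, -1, Or.inr rfl, Or.inl ⟨by decide, by decide⟩⟩
example : InFivePencilFamily 11 1 :=           -- `Q = −1`:   (F₁₀/5, F₅/5), n = −5, s = −1
  ⟨-5, -1, Or.inr rfl, Or.inr (Or.inl ⟨by decide, by decide⟩)⟩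
example : InFivePencilFamily 18 1 :=           -- `Q = 125`:  (L₆, L₁), n = −1, s = 1
  ⟨-1, 1, Or.inl rfl, Or.inr (Or.inr ⟨by decide, by decide⟩)⟩
example : InFivePencilFamily 76 7 :=           -- `Q = −125`: (L₉, L₄), n = −4, s = −1 (`76 = 11·7 − 1`)
  ⟨-4, -1, Or.inr rfl, Or.inr (Or.inr ⟨by decide, by decide⟩)⟩

end Summit.ABC.ABC.Cruxes.GoldenCuspShadow.SplitCuspIdeas3
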